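import Mathlib
import Literature.Analysis.FluidPDE.VectorCalculus
import Summits.NavierStokesRegularity.NavierStokesRegularity.Theorems.FilamentSkeletonRssClause13RAdjointWaistExistence
import Summits.NavierStokesRegularity.NavierStokesRegularity.Theorems.FilamentSkeletonRssClause13RAdjointWaistContinuity

/-!
# Clause 13-R, STUB R at MODEL level: the waist-regular branch as ONE CONTINUOUS DENSITY ACROSS THE STAGNATION POINT
# (census item (R-c′-E), local half — assembled; crux `Clause13RNearStraightL`, stmt-NavierStokesRegularity-23612; line `rate_bordered_split`,
# STUB R `stub_rateRow13RFlat`)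

Route `FilamentSkeletonRss`, Variant A1R.  Assembly of `…Clause13RAdjointWaistExistence` (p836869: existence of the waist-regular branch of the sourced
local MODEL adjoint equation `w φ′ + (½ + w′)φ + α e × φ + cst·m (φ × d) = g` on each punctured half-ball) and `…Clause13RAdjointWaistContinuity`
(p836980: continuity at the waist with the algebraic waist value).  RESULT (`exists_continuous_waistRegular_branch`): on a ball `(a, b) ∋ c` where the
`C¹` slip vanishes at `c` and opens at least linearly on both sides (`κ₁(s − c) ≤ w(s)` right of `c`, `κ₁(c − s) ≤ −w(s)` left of `c`), for continuous
weight `m` and source `g` (`‖g‖ ≤ G` on `[a, b]`), there is ONE function `φ`, CONTINUOUS on `(a, b)`, differentiable on `(a, b) ∖ {c}` where it solves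
the sourced local adjoint equation, satisfying the algebraic waist equation AT `c`, waist-regular (`|w(s)|‖φ(s)‖ ≤ G|s − c|`) and bounded by the source
alone on the whole ball, `‖φ‖ ≤ G/κ₁` (at the waist via `w′(c) ≥ κ₁`, `deriv_ge_of_linear_opening`).  This is exactly the input class («differentiable on
`S ∖ {c}`, bounded on `S`, nothing assumed at `c`») of the landed uniqueness / a-priori statements `…Clause13RAdjointPunctured(Unique/Apriori)`
(p832184/p832285/p832351), now shown to be NONEMPTY for every continuous source and populated by continuous densities: the local solution operator
`g ↦ φ` of census item (R-c′-E) is well defined on `C(S)`; what remains of (R-c′-E) at model level is the global Fredholm step for the compact nonlocal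
term (`IsCompactOperator.hasEigenvalue_or_mem_resolventSet` in Mathlib + p832285).  [folklore]
Hand `leafhand-ns-filamentskeletonrs-25-g0` (LAND-ONLY); `--supports stmt-NavierStokesRegularity-23612` helper, def-free.  HONEST FRAMING: ODE bookkeeping for the
MODEL adjoint equation attached to a HYPOTHETICAL filament skeleton on the NEGATIVE side of a MODEL blow-up route; STUB R is NOT proved here and nothing in
this file bears on Navier–Stokes regularity or blow-up.
-/

noncomputable section

open MeasureTheory Filter Topology Set Metric
open scoped RealInnerProductSpace InnerProductSpace
open Literature.Analysis.FluidPDE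
open Summit.NavierStokesRegularity.NavierStokesRegularity.Theorems.Clause13RAdjointWaistExistence
  (exists_waistRegular_branch_right exists_waistRegular_branch_left)
open Summit.NavierStokesRegularity.NavierStokesRegularity.Theorems.Clause13RAdjointWaistContinuity
  (inner_waistOp_self exists_waistValue tendsto_waistValue_right tendsto_waistValue_left)

namespace Summit.NavierStokesRegularity.NavierStokesRegularity.Theorems.Clause13RAdjointWaistBranch
set_option linter.dupNamespace false

/-! ## §1 The slip derivative at the waist and the size of the waist value -/

/-- A `C¹` slip with `w(c) = 0` and `κ₁(s − c) ≤ w(s)` to the right of `c` has `w′(c) ≥ κ₁`. [folklore] -/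
theorem deriv_ge_of_linear_opening {c b κ₁ wc' : ℝ} {w : ℝ → ℝ} (hcb : c < b) (hw : HasDerivAt w wc' c) (hwc0 : w c = 0)
    (hwR : ∀ s ∈ Icc c b, κ₁ * (s - c) ≤ w s) : κ₁ ≤ wc' := by
  have ht := hw.tendsto_slope_zero_right
  have hev : ∀ᶠ t in 𝓝[>] (0 : ℝ), κ₁ ≤ t⁻¹ • (w (c + t) - w c) := by
    filter_upwards [Ioc_mem_nhdsGT (sub_pos.2 hcb)] with t ht
    have h := hwR (c + t) ⟨by linarith [ht.1], by linarith [ht.2]⟩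
    rw [hwc0, sub_zero, smul_eq_mul]
    rw [show c + t - c = t by ring] at h
    rw [le_inv_mul_iff₀ ht.1]
    linarith
  exact ge_of_tendsto ht hev

/-- The waist value is bounded by the source: `(s + skew) x = y` ⇒ `s‖x‖ ≤ ‖y‖`. [folklore] -/
theorem norm_waistValue_le {s α cm : ℝ} {d e x y : EuclideanSpace ℝ (Fin 3)}
    (h : s • x + α • cross e x + cm • cross x d = y) : s * ‖x‖ ≤ ‖y‖ := by
  have h1 := inner_waistOp_self s α cm d e x
  rw [h] at h1
  have h2 : s * ‖x‖ ^ 2 ≤ ‖y‖ * ‖x‖ := by rw [← h1]; exact real_inner_le_norm _ _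
  by_cases hx : ‖x‖ = 0
  · rw [hx, mul_zero]; exact norm_nonneg _
  · have hxp : 0 < ‖x‖ := lt_of_le_of_ne (norm_nonneg _) (Ne.symm hx)
    nlinarith

/-! ## §2 The continuous waist-regular branch on the whole ball -/

/-- **THE WAIST-REGULAR BRANCH IS A CONTINUOUS DENSITY ON THE WHOLE BALL.**  Slip `w ∈ C¹(ℝ)` (`w′` continuous) with `w(c) = 0`, opening at least
linearly on both sides of the waist inside the ball `(a, b) ∋ c`: `κ₁(s − c) ≤ w(s)` on `[c, b]`, `κ₁(c − s) ≤ −w(s)` on `[a, c]` (`κ₁ > 0`);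
continuous weight `m` and source `g` with `‖g‖ ≤ G` on `[a, b]`; constants `α, cst`, vectors `d, e`.  Then there are `φ, φ′` with: `φ` continuous on
`(a, b)`; `φ′` its derivative at every station of `(a, b) ∖ {c}`, where the sourced local adjoint equation
`w φ′ + ½φ + w′φ + α e × φ + cst·m (φ × d) = g` holds; the algebraic waist equation `½φ(c) + w′(c)φ(c) + α e × φ(c) + cst·m(c)(φ(c) × d) = g(c)` at
the waist; and the bounds `|w(s)|‖φ(s)‖ ≤ G|s − c|`, `‖φ(s)‖ ≤ G/κ₁` on all of `(a, b)`. [folklore] -/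
theorem exists_continuous_waistRegular_branch {a b c κ₁ G α cst : ℝ} {m w w' : ℝ → ℝ} {g : ℝ → EuclideanSpace ℝ (Fin 3)}
    {d e : EuclideanSpace ℝ (Fin 3)} (hac : a < c) (hcb : c < b) (hκ₁ : 0 < κ₁)
    (hw : ∀ s, HasDerivAt w (w' s) s) (hw'c : Continuous w') (hm : Continuous m) (hg : Continuous g) (hwc0 : w c = 0)
    (hwR : ∀ s ∈ Icc c b, κ₁ * (s - c) ≤ w s) (hwL : ∀ s ∈ Icc a c, κ₁ * (c - s) ≤ -w s) (hG : ∀ s ∈ Icc a b, ‖g s‖ ≤ G) :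
    ∃ φ φ' : ℝ → EuclideanSpace ℝ (Fin 3),
      ContinuousOn φ (Ioo a b) ∧
      (∀ s ∈ Ioo a b, s ≠ c → HasDerivAt φ (φ' s) s) ∧
      (∀ s ∈ Ioo a b, s ≠ c →
        w s • φ' s + (1 / 2 : ℝ) • φ s + w' s • φ s + α • cross e (φ s) + (cst * m s) • cross (φ s) d = g s) ∧
      ((1 / 2 : ℝ) • φ c + w' c • φ c + α • cross e (φ c) + (cst * m c) • cross (φ c) d = g c) ∧
      (∀ s ∈ Ioo a b, |w s| * ‖φ s‖ ≤ G * |s - c|) ∧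
      (∀ s ∈ Ioo a b, ‖φ s‖ ≤ G / κ₁) := by
  have hG0 : 0 ≤ G := (norm_nonneg _).trans (hG c ⟨hac.le, hcb.le⟩)
  -- the two half-branches
  obtain ⟨φR, φR', hRd, hReq, hRb, hRs⟩ := exists_waistRegular_branch_right (α := α) (cst := cst) (m := m) (d := d) (e := e) hcb hκ₁ hw
    hw'c hm hg hwR (fun s hs => hG s ⟨hac.le.trans hs.1, hs.2⟩)
  obtain ⟨φL, φL', hLd, hLeq, hLb, hLs⟩ := exists_waistRegular_branch_left (α := α) (cst := cst) (m := m) (d := d) (e := e) hac hκ₁ hw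
    hw'c hm hg hwL (fun s hs => hG s ⟨hs.1, hs.2.trans hcb.le⟩)
  -- the waist value
  have hw'c_ge : κ₁ ≤ w' c := deriv_ge_of_linear_opening hcb (hw c) hwc0 hwR
  have hs : 0 < 1 / 2 + w' c := by linarith
  obtain ⟨xc, hxc⟩ := exists_waistValue (α := α) (cm := cst * m c) hs d e (g c)
  have hxc' : (1 / 2 : ℝ) • xc + w' c • xc + α • cross e xc + (cst * m c) • cross xc d = g c := by
    rw [← hxc, add_smul]
  have hxc_norm : ‖xc‖ ≤ G / κ₁ := by
    have h1 := norm_waistValue_le hxc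
    have h2 : ‖g c‖ ≤ G := hG c ⟨hac.le, hcb.le⟩
    rw [le_div_iff₀ hκ₁]
    nlinarith [norm_nonneg xc]
  -- the glued function
  set φ : ℝ → EuclideanSpace ℝ (Fin 3) := fun s => if s < c then φL s else if s = c then xc else φR s with hφ
  set φ' : ℝ → EuclideanSpace ℝ (Fin 3) := fun s => if s < c then φL' s else φR' s with hφ'
  have hφ_lt : ∀ s, s < c → φ s = φL s := fun s hs => by simp only [hφ, if_pos hs]
  have hφ_gt : ∀ s, c < s → φ s = φR s := fun s hs => by simp only [hφ, if_neg (not_lt.2 hs.le), if_neg (ne_of_gt hs)]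
  have hφ_c : φ c = xc := by simp only [hφ, lt_irrefl, if_false, if_true]
  have hφ'_lt : ∀ s, s < c → φ' s = φL' s := fun s hs => by simp only [hφ', if_pos hs]
  have hφ'_gt : ∀ s, c < s → φ' s = φR' s := fun s hs => by simp only [hφ', if_neg (not_lt.2 hs.le)]
  have hev_lt : ∀ s, s < c → φ =ᶠ[𝓝 s] φL := fun s hs => by
    filter_upwards [Iio_mem_nhds hs] with x hx using hφ_lt x hx
  have hev_gt : ∀ s, c < s → φ =ᶠ[𝓝 s] φR := fun s hs => by
    filter_upwards [Ioi_mem_nhds hs] with x hx using hφ_gt x hx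
  -- derivative and equation off the waist
  have hder : ∀ s ∈ Ioo a b, s ≠ c → HasDerivAt φ (φ' s) s := by
    intro s hs hsc
    rcases lt_or_gt_of_ne hsc with hlt | hgt
    · rw [hφ'_lt s hlt]
      exact (hLd s ⟨hs.1, hlt⟩).congr_of_eventuallyEq (hev_lt s hlt)
    · rw [hφ'_gt s hgt]
      exact (hRd s ⟨hgt, hs.2⟩).congr_of_eventuallyEq (hev_gt s hgt)
  have heqn : ∀ s ∈ Ioo a b, s ≠ c →
      w s • φ' s + (1 / 2 : ℝ) • φ s + w' s • φ s + α • cross e (φ s) + (cst * m s) • cross (φ s) d = g s := by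
    intro s hs hsc
    rcases lt_or_gt_of_ne hsc with hlt | hgt
    · rw [hφ'_lt s hlt, hφ_lt s hlt]; exact hLeq s ⟨hs.1, hlt⟩
    · rw [hφ'_gt s hgt, hφ_gt s hgt]; exact hReq s ⟨hgt, hs.2⟩
  -- one-sided limits at the waist
  set aL : ℝ := (a + c) / 2 with haL
  set bR : ℝ := (c + b) / 2 with hbR
  have haL1 : a < aL := by rw [haL]; linarith
  have haL2 : aL < c := by rw [haL]; linarith
  have hbR1 : c < bR := by rw [hbR]; linarith
  have hbR2 : bR < b := by rw [hbR]; linarith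
  have hright : Tendsto φR (𝓝[>] c) (𝓝 xc) :=
    tendsto_waistValue_right (σ₁ := bR) (M := G / κ₁) hbR1 hκ₁ hw hwc0 hw'c.continuousAt hm.continuousAt hg.continuousAt
      (fun s hs => hwR s ⟨hs.1.le, hs.2.trans hbR2.le⟩) (fun s hs => hRd s ⟨hs.1, lt_of_le_of_lt hs.2 hbR2⟩)
      (fun s hs => hRs s ⟨hs.1, lt_of_le_of_lt hs.2 hbR2⟩) (fun s hs => hReq s ⟨hs.1, lt_of_le_of_lt hs.2 hbR2⟩) hxc'
  have hleft : Tendsto φL (𝓝[<] c) (𝓝 xc) :=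
    tendsto_waistValue_left (σ₁ := aL) (M := G / κ₁) haL2 hκ₁ hw hwc0 hw'c.continuousAt hm.continuousAt hg.continuousAt
      (fun s hs => hwL s ⟨haL1.le.trans hs.1, hs.2.le⟩) (fun s hs => hLd s ⟨lt_of_lt_of_le haL1 hs.1, hs.2⟩)
      (fun s hs => hLs s ⟨lt_of_lt_of_le haL1 hs.1, hs.2⟩) (fun s hs => hLeq s ⟨lt_of_lt_of_le haL1 hs.1, hs.2⟩) hxc'
  have hcont_c : ContinuousAt φ c := by
    rw [continuousAt_iff_continuous_left'_right']
    constructor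
    · rw [ContinuousWithinAt, hφ_c]
      refine hleft.congr' ?_
      exact eventually_of_mem self_mem_nhdsWithin fun s hs => (hφ_lt s hs).symm
    · rw [ContinuousWithinAt, hφ_c]
      refine hright.congr' ?_
      exact eventually_of_mem self_mem_nhdsWithin fun s hs => (hφ_gt s hs).symm
  have hcont : ContinuousOn φ (Ioo a b) := by
    intro s hs
    by_cases hsc : s = c
    · rw [hsc]; exact hcont_c.continuousWithinAt
    · exact (hder s hs hsc).continuousAt.continuousWithinAt
  -- bounds
  have hwb : ∀ s ∈ Ioo a b, |w s| * ‖φ s‖ ≤ G * |s - c| := by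
    intro s hs
    rcases lt_trichotomy s c with hlt | heq | hgt
    · have h := hLb s ⟨hs.1, hlt⟩
      have hwneg : w s ≤ 0 := by
        have := hwL s ⟨hs.1.le, hlt.le⟩
        nlinarith [mul_nonneg hκ₁.le (sub_nonneg.2 hlt.le)]
      rw [hφ_lt s hlt, abs_of_nonpos hwneg, abs_of_neg (sub_neg.2 hlt), neg_sub]
      exact h
    · rw [heq, hwc0, abs_zero, zero_mul, sub_self, abs_zero, mul_zero]
    · have h := hRb s ⟨hgt, hs.2⟩
      have hwpos : 0 ≤ w s := (mul_nonneg hκ₁.le (sub_nonneg.2 hgt.le)).trans (hwR s ⟨hgt.le, hs.2.le⟩)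
      rw [hφ_gt s hgt, abs_of_nonneg hwpos, abs_of_pos (sub_pos.2 hgt)]
      exact h
  have hsup : ∀ s ∈ Ioo a b, ‖φ s‖ ≤ G / κ₁ := by
    intro s hs
    rcases lt_trichotomy s c with hlt | heq | hgt
    · rw [hφ_lt s hlt]; exact hLs s ⟨hs.1, hlt⟩
    · rw [heq, hφ_c]; exact hxc_norm
    · rw [hφ_gt s hgt]; exact hRs s ⟨hgt, hs.2⟩
  refine ⟨φ, φ', hcont, hder, heqn, ?_, hwb, hsup⟩
  rw [hφ_c]; exact hxc'

end Summit.NavierStokesRegularity.NavierStokesRegularity.Theorems.Clause13RAdjointWaistBranch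

end
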